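import Literature.NumberTheory.Irrationality.RhinViola2001.OmegaSets
import Literature.NumberTheory.Transcendental.ZetaLinearFormsCriterion
import HarnessLib

/-!
# Rhin–Viola 2001, (5.14): `lim (1/n) log D_n = M + N + Q − (∫_{Ω_E} dψ + ∫_{Ω′_E} dψ)` from the prime number theorem

Topic `Literature/NumberTheory/Irrationality/RhinViola2001`. Typed-and-PROVED (no named fact; cell `zeta5-irr`, seat
zi-lit g17) from G. Rhin, C. Viola, *The group structure for ζ(3)*, Acta Arith. **97** (2001) 269–293 [RhinViola2001],
§5 p. 290 (held text `paper:doi-10-4064-aa97-3-6`, p0022–p0023), with Rhin–Viola 1996 (Acta Arith. **77**) p. 51 for the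
argument ("As is shown by Hata …, the last two limits exist and can be easily computed by means of `ψ(x) = Γ′(x)/Γ(x)` …
`lim (1/n) log Δ_n = ∫_Ω dψ(x)`"):

> "As in [4], p. 51, we see that (5.14) `lim_{n→∞} (1/n) log D_n = M + N + Q − (∫_{Ω_E} dψ(x) + ∫_{Ω′_E} dψ(x))`,
> where `ψ(x) = Γ′(x)/Γ(x)`."

For a union `Ω` of disjoint intervals `[u, v) ⊂ (0,1)`, `∫_Ω dψ = Σ_{[u,v)} (ψ(v) − ψ(u))` and
`ψ(v) − ψ(u) = Σ_{k ≥ 0} (1/(k+u) − 1/(k+v))`; THIS file renders `∫ dψ` by that series (`rowSeries`, `intDpsi`) and proves,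
for the record data of `OmegaSets.lean` (`Δ_n = Delta n`, `Δ′_n = Delta' n`, `D_n = bigD n`, `M, N, Q = 19, 18, 17`):
`(1/n) log Δ_n → ∫_{Ω_E} dψ` (`tendsto_log_Delta_div`), `(1/n) log Δ′_n → ∫_{Ω′_E} dψ` (`tendsto_log_Delta'_div`), and
**(5.14)** `(1/n) log D_n → 54 − (∫_{Ω_E} dψ + ∫_{Ω′_E} dψ)` (`tendsto_log_bigD_div`). The proof is the printed "follows
from the prime number theorem" made explicit exactly as in the tree's `RivoalZudilin2020/PhiAsymptoticsProofs.lean`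
(whose private lemmas are adapted here to primes up to `19n` and blocks `k ≥ 0`): for a mark `a ∈ [1/19, 1)` and `K`,
`Σ_{k<K} (ϑ(n/(k+a)) − ϑ(n/(k+1))) = Σ_{p ≤ 19n, p > n/K} 𝟙[{n/p} ≥ a] log p` (`blockT_eq`), `𝟙_{[u,v)} = 𝟙[· ≥ u] − 𝟙[· ≥ v]`,
the rows of `Ω_E`, `Ω′_E` are pairwise disjoint (kernel check `omegaRows_separated`), the primes `√(19n) < p ≤ n/K` contribute
at most `ϑ(n/K) ≤ (log 4) n/K`, and `ϑ(x) ~ x` (tree: `chebyshevTheta_isEquivalent`), `log d_m/m → 1` (tree: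
`tendsto_log_lcmUpto_div`).

Numerics: two-decimal windows `18.04 < ∫_{Ω_E} dψ < 18.05`, `6.14 < ∫_{Ω′_E} dψ < 6.15`, hence `29.80 < c₂ < 29.82`
(`intDpsi_omegaRows_window`, `intDpsi_omegaRows'_window`, `c2_window`; twelve terms of each row series and telescoping
tail bounds, exact rational arithmetic), and the SHARP lower bound `∫_{Ω_E} dψ + ∫_{Ω′_E} dψ ≥ 24.1876850974`, i.e.
`c₂ ≤ 29.8123149026` (`intDpsi_lower_sharp`, `c2_le_sharp`: sixty terms per row and second-order telescoping tails,
evaluated exactly over `ℚ` by the kernel, `decide +kernel`). What is NOT here: the printed eight decimals themselves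
(`18.04470204…`, `6.14298325…`, `c₂ = 29.81231469…`) as two-sided statements.

HONEST FRAMING (cells pub-zeta5 / zeta5-irr): an asymptotic statement about a 2001 record's denominators, as printed;
no measure asserted; records in print unmoved; nothing about `ζ(5)`.
-/

noncomputable section

namespace Literature.NumberTheory.Irrationality.RhinViola2001

namespace Section5

open Finset Filter Topology Asymptotics

/-! ### `ϑ`-blocks: `Σ_{k<K} (ϑ(n/(k+a)) − ϑ(n/(k+1))) = Σ_{p ≤ 19n, p > n/K} 𝟙[{n/p} ≥ a] log p` -/

/-- The prime universe `p ≤ 19n`. [cite: RhinViola2001, §5 p. 290 (Lemma 5.1: `p ∣ Δ_n ⇒ p ≤ Mn`)] -/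
def primesUpTo19 (n : ℕ) : Finset ℕ := (Ioc 0 (19 * n)).filter Nat.Prime

/-- For `0 ≤ y ≤ 19n`: `ϑ(y) = Σ_{p ≤ 19n prime} 𝟙[p ≤ y] log p`. [folklore] -/
private theorem theta_eq_sum_ite (n : ℕ) {y : ℝ} (hy0 : 0 ≤ y) (hyn : y ≤ 19 * n) :
    Chebyshev.theta y = ∑ p ∈ primesUpTo19 n, if (p : ℝ) ≤ y then Real.log p else 0 := by
  rw [Chebyshev.theta, ← Finset.sum_filter]
  refine Finset.sum_congr ?_ fun _ _ => rfl
  ext p; simp only [primesUpTo19, mem_filter, mem_Ioc]; constructor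
  · rintro ⟨⟨hp0, hpy⟩, hp⟩
    have hpy' : (p : ℝ) ≤ y := (Nat.le_floor_iff hy0).1 hpy
    exact ⟨⟨⟨hp0, by exact_mod_cast hpy'.trans hyn⟩, hp⟩, hpy'⟩
  · rintro ⟨⟨⟨hp0, -⟩, hp⟩, hpy⟩
    exact ⟨⟨hp0, (Nat.le_floor_iff hy0).2 hpy⟩, hp⟩

/-- One block `k = i ≥ 0`, mark `a ∈ [1/19, 1)`: `ϑ(n/(i+a)) − ϑ(n/(i+1)) = Σ_{p ≤ 19n} 𝟙[n/(i+1) < p ≤ n/(i+a)] log p`.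
[folklore] -/
private theorem theta_sub_theta_eq (n i : ℕ) {a : ℝ} (ha0 : 0 < a) (ha1 : a < 1) (haB : 1 ≤ 19 * a) :
    Chebyshev.theta (n / ((i : ℝ) + a)) - Chebyshev.theta (n / ((i : ℝ) + 1)) =
      ∑ p ∈ primesUpTo19 n,
        if (n : ℝ) / ((i : ℝ) + 1) < p ∧ (p : ℝ) ≤ n / ((i : ℝ) + a) then Real.log p else 0 := by
  have hn : (0 : ℝ) ≤ n := n.cast_nonneg
  have hi : (0 : ℝ) ≤ i := i.cast_nonneg
  have hmono : (n : ℝ) / ((i : ℝ) + 1) ≤ n / ((i : ℝ) + a) :=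
    div_le_div_of_nonneg_left hn (by positivity) (by linarith)
  have hbig : (n : ℝ) / ((i : ℝ) + a) ≤ 19 * n := by
    rw [div_le_iff₀ (by positivity)]; nlinarith
  rw [theta_eq_sum_ite n (by positivity) (hmono.trans hbig), theta_eq_sum_ite n (by positivity) hbig,
    ← Finset.sum_sub_distrib]
  refine Finset.sum_congr rfl fun p _ => ?_
  by_cases c2 : (p : ℝ) ≤ n / ((i : ℝ) + 1)
  · rw [if_pos (c2.trans hmono), if_pos c2, if_neg (fun h => (not_lt.2 c2) h.1), sub_self]
  · by_cases c1 : (p : ℝ) ≤ n / ((i : ℝ) + a)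
    · rw [if_pos c1, if_neg c2, if_pos ⟨not_le.1 c2, c1⟩, sub_zero]
    · rw [if_neg c1, if_neg c2, if_neg (fun h => c1 h.2), sub_zero]

/-- For `x ≥ 0`, `0 < a ≤ 1`: `Σ_{i<K} 𝟙[i + a ≤ x < i+1] = 𝟙[x < K ∧ a ≤ {x}]`. [folklore] -/
private theorem sum_indicator_floor {x a : ℝ} (hx0 : 0 ≤ x) (ha0 : 0 < a) (K : ℕ) :
    ∑ i ∈ range K, (if (i : ℝ) + a ≤ x ∧ x < (i : ℝ) + 1 then (1 : ℝ) else 0) =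
      if x < K ∧ a ≤ Int.fract x then 1 else 0 := by
  set m := ⌊x⌋₊ with hm
  have hxm : x < m + 1 := Nat.lt_floor_add_one x
  have hmx : (m : ℝ) ≤ x := Nat.floor_le hx0
  have hfract : Int.fract x = x - m := by rw [Int.fract, hm, natCast_floor_eq_intCast_floor hx0]
  have key : ∀ i : ℕ, ((i : ℝ) + a ≤ x ∧ x < (i : ℝ) + 1) ↔ (i = m ∧ a ≤ Int.fract x) := by
    intro i
    constructor
    · rintro ⟨h1, h2⟩
      have hk : ⌊x⌋₊ = i := by rw [Nat.floor_eq_iff hx0]; exact ⟨by linarith, by linarith⟩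
      refine ⟨by omega, ?_⟩
      rw [hfract, hm, hk]; linarith
    · rintro ⟨rfl, h2⟩
      rw [hfract] at h2
      exact ⟨by linarith, hxm⟩
  simp_rw [key, ite_and]
  rw [Finset.sum_ite_eq']
  have hmem : m ∈ range K ↔ x < K := by
    rw [mem_range, hm, Nat.floor_lt hx0]
  by_cases hK : x < K
  · simp [hmem.2 hK, hK]
  · simp [mt hmem.1 hK, hK]

/-- **The block sum of one mark** `a ∈ [1/19, 1)`:
`Σ_{k<K} (ϑ(n/(k+a)) − ϑ(n/(k+1))) = Σ_{p ≤ 19n prime, n < Kp} 𝟙[{n/p} ≥ a] log p`. [folklore] -/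
private theorem blockT_eq (n K : ℕ) {a : ℝ} (ha0 : 0 < a) (ha1 : a < 1) (haB : 1 ≤ 19 * a) :
    ∑ i ∈ range K, (Chebyshev.theta (n / ((i : ℝ) + a)) - Chebyshev.theta (n / ((i : ℝ) + 1))) =
      ∑ p ∈ primesUpTo19 n,
        if (n : ℝ) < K * p then (if a ≤ Int.fract ((n : ℝ) / p) then (1 : ℝ) else 0) * Real.log p else 0 := by
  rw [Finset.sum_congr rfl fun i _ => theta_sub_theta_eq n i ha0 ha1 haB, Finset.sum_comm]
  refine Finset.sum_congr rfl fun p hp => ?_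
  obtain ⟨⟨hp0, -⟩, -⟩ : (0 < p ∧ p ≤ 19 * n) ∧ p.Prime := by simpa [primesUpTo19, mem_filter, mem_Ioc] using hp
  have hp : (0 : ℝ) < p := by exact_mod_cast hp0
  have hx0 : (0 : ℝ) ≤ n / p := by positivity
  have e1 : ∀ c : ℝ, 0 < c → ((n : ℝ) / c < p ↔ (n : ℝ) / p < c) := fun c hc => by
    rw [div_lt_iff₀ hc, div_lt_iff₀ hp, mul_comm]
  have e2 : ∀ c : ℝ, 0 < c → ((p : ℝ) ≤ n / c ↔ c ≤ (n : ℝ) / p) := fun c hc => by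
    rw [le_div_iff₀ hc, le_div_iff₀ hp, mul_comm]
  have hmul : ∀ i : ℕ, (if (n : ℝ) / ((i : ℝ) + 1) < p ∧ (p : ℝ) ≤ n / ((i : ℝ) + a)
      then Real.log p else 0) =
      (if (i : ℝ) + a ≤ n / p ∧ (n : ℝ) / p < (i : ℝ) + 1 then (1 : ℝ) else 0) * Real.log p := by
    intro i
    have hc : ((n : ℝ) / ((i : ℝ) + 1) < p ∧ (p : ℝ) ≤ n / ((i : ℝ) + a)) ↔
        ((i : ℝ) + a ≤ n / p ∧ (n : ℝ) / p < (i : ℝ) + 1) := by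
      rw [e1 _ (by positivity), e2 _ (by positivity), and_comm]
    by_cases h : (i : ℝ) + a ≤ n / p ∧ (n : ℝ) / p < (i : ℝ) + 1
    · rw [if_pos h, if_pos (hc.2 h), one_mul]
    · rw [if_neg h, if_neg (mt hc.1 h), zero_mul]
  simp_rw [hmul]
  rw [← Finset.sum_mul, sum_indicator_floor hx0 ha0 K]
  have eK : (n : ℝ) < K * p ↔ (n : ℝ) / p < K := by rw [div_lt_iff₀ hp]
  by_cases h1 : (n : ℝ) < K * p
  · rw [if_pos h1]
    by_cases h2 : a ≤ Int.fract ((n : ℝ) / p)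
    · rw [if_pos ⟨eK.1 h1, h2⟩, if_pos h2]
    · rw [if_neg (fun h => h2 h.2), if_neg h2]
  · rw [if_neg h1, if_neg (fun h => h1 (eK.2 h.1)), zero_mul]

/-- `ϑ(n/c)/n → 1/c` (prime number theorem `ϑ(x) ~ x`, tree: `chebyshevTheta_isEquivalent`). [folklore] -/
private theorem tendsto_theta_div {c : ℝ} (hc : 0 < c) :
    Tendsto (fun n : ℕ => Chebyshev.theta (n / c) / n) atTop (𝓝 (1 / c)) := by
  have h1 : Tendsto (fun x : ℝ => Chebyshev.theta x / x) atTop (𝓝 1) :=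
    ((isEquivalent_iff_tendsto_one (eventually_ne_atTop 0)).1
      Literature.NumberTheory.LFunctions.chebyshevTheta_isEquivalent).congr fun x => rfl
  have h3 := (h1.comp (tendsto_natCast_atTop_atTop.atTop_div_const hc)).mul_const (1 / c)
  rw [one_mul] at h3
  refine h3.congr' ?_
  filter_upwards [eventually_gt_atTop 0] with n hn
  have hn' : (0 : ℝ) < n := by exact_mod_cast hn
  simp only [Function.comp_def]; field_simp

/-- `(block sum of the mark a)/n → Σ_{k<K} (1/(k+a) − 1/(k+1))`. [folklore] -/
private theorem tendsto_blockT_div {a : ℝ} (ha : 0 < a) (K : ℕ) :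
    Tendsto (fun n : ℕ => (∑ i ∈ range K, (Chebyshev.theta (n / ((i : ℝ) + a)) - Chebyshev.theta (n / ((i : ℝ) + 1)))) / n)
      atTop (𝓝 (∑ i ∈ range K, (1 / ((i : ℝ) + a) - 1 / ((i : ℝ) + 1)))) := by
  simp only [sum_div, sub_div]
  exact tendsto_finsetSum _ fun i _ =>
    (tendsto_theta_div (by positivity)).sub (tendsto_theta_div (by positivity))

/-! ### Rows: well-formedness, marks, indicators -/

/-- Well-formedness of a row `[u, v)`: positive denominators, `1/19 ≤ u ≤ v < 1`. [cite: RhinViola2001, §5 p. 292, Lemma 5.1] -/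
def Row.wf (t : Row) : Bool :=
  decide (0 < t.uD) && decide (0 < t.vD) && decide (t.uD ≤ 19 * t.uN) && decide (t.uN * t.vD ≤ t.vN * t.uD) &&
    decide (t.vN < t.vD)

/-- The left mark `u = u_N/u_D` of a row. [cite: RhinViola2001, §5 p. 292] -/
def Row.lo (t : Row) : ℝ := (t.uN : ℝ) / t.uD

/-- The right mark `v = v_N/v_D` of a row. [cite: RhinViola2001, §5 p. 292] -/
def Row.hi (t : Row) : ℝ := (t.vN : ℝ) / t.vD

/-- Consequences of well-formedness: `0 < u`, `1 ≤ 19u`, `u ≤ v`, `v < 1` (hence `u < 1`, `0 < v`, `1 ≤ 19 v`). [folklore] -/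
private theorem Row.wf_sound {t : Row} (h : t.wf = true) :
    0 < t.lo ∧ 1 ≤ 19 * t.lo ∧ t.lo ≤ t.hi ∧ t.hi < 1 := by
  simp only [Row.wf, Bool.and_eq_true, decide_eq_true_eq] at h
  obtain ⟨⟨⟨⟨huD, hvD⟩, h19⟩, hle⟩, hlt⟩ := h
  have huDr : (0 : ℝ) < t.uD := by exact_mod_cast huD
  have hvDr : (0 : ℝ) < t.vD := by exact_mod_cast hvD
  have h19r : (t.uD : ℝ) ≤ 19 * t.uN := by exact_mod_cast h19
  have hler : (t.uN : ℝ) * t.vD ≤ t.vN * t.uD := by exact_mod_cast hle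
  have hltr : (t.vN : ℝ) < t.vD := by exact_mod_cast hlt
  have huN : (0 : ℝ) < t.uN := by linarith
  refine ⟨div_pos huN huDr, ?_, ?_, ?_⟩
  · rw [Row.lo, mul_div_assoc', le_div_iff₀ huDr]; linarith
  · rw [Row.lo, Row.hi, div_le_div_iff₀ huDr hvDr]; exact hler
  · rw [Row.hi, div_lt_one hvDr]; exact hltr

open Classical in
/-- `𝟙_{[u,v)}(ω) = 𝟙[u ≤ ω] − 𝟙[v ≤ ω]` for `u ≤ v`. [folklore] -/
private theorem Row.indicator_eq {t : Row} (h : t.wf = true) (ω : ℝ) :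
    (if ω ∈ t.toSet then (1 : ℝ) else 0) = (if t.lo ≤ ω then (1 : ℝ) else 0) - (if t.hi ≤ ω then (1 : ℝ) else 0) := by
  have hle := (Row.wf_sound h).2.2.1
  have hmem : ω ∈ t.toSet ↔ t.lo ≤ ω ∧ ω < t.hi := by simp [Row.toSet, Row.lo, Row.hi, Set.mem_Ico]
  by_cases h1 : t.lo ≤ ω
  · by_cases h2 : t.hi ≤ ω
    · rw [if_neg (fun hm => (not_lt.2 h2) (hmem.1 hm).2), if_pos h1, if_pos h2]; ring
    · rw [if_pos (hmem.2 ⟨h1, not_le.1 h2⟩), if_pos h1, if_neg h2]; ring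
  · have h2 : ¬ t.hi ≤ ω := fun h2 => h1 (hle.trans h2)
    rw [if_neg (fun hm => h1 (hmem.1 hm).1), if_neg h1, if_neg h2]; ring

/-- Separation of two rows `s` before `t`: `v_s ≤ u_t` (cross-multiplied; the printed intervals are disjoint and listed
in increasing order). [cite: RhinViola2001, §5 p. 292] -/
abbrev Row.sep (s t : Row) : Prop := s.vN * t.uD ≤ t.uN * s.vD

open Classical in
/-- For rows listed in increasing order and pairwise separated, the indicators of the rows add up to the indicator of
their union. [folklore] -/
private theorem indicator_union_eq_sum : ∀ (rows : List Row), rows.all Row.wf = true → rows.Pairwise Row.sep →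
    ∀ ω : ℝ, (if ∃ t ∈ rows, ω ∈ t.toSet then (1 : ℝ) else 0) = (rows.map fun t => if ω ∈ t.toSet then (1 : ℝ) else 0).sum
  | [], _, _, ω => by simp
  | t :: ts, hwf, hsep, ω => by
    simp only [List.all_cons, Bool.and_eq_true] at hwf
    obtain ⟨hwt, hwts⟩ := hwf
    rw [List.pairwise_cons] at hsep
    obtain ⟨hst, hts⟩ := hsep
    have ih := indicator_union_eq_sum ts hwts hts ω
    rw [List.map_cons, List.sum_cons, ← ih]
    by_cases hω : ω ∈ t.toSet
    · -- `ω < v_t ≤ u_s` for every later row `s`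
      have hnone : ¬ ∃ s ∈ ts, ω ∈ s.toSet := by
        rintro ⟨s, hs, hωs⟩
        have hsep' := hst s hs
        have hws := (List.all_eq_true.1 hwts) s hs
        simp only [Row.wf, Bool.and_eq_true, decide_eq_true_eq] at hwt hws
        have hvD : (0 : ℝ) < t.vD := by exact_mod_cast hwt.1.1.1.2
        have huD : (0 : ℝ) < s.uD := by exact_mod_cast hws.1.1.1.1
        have h1 : ω < (t.vN : ℝ) / t.vD := hω.2
        have h2 : (s.uN : ℝ) / s.uD ≤ ω := hωs.1
        have h3 : (t.vN : ℝ) / t.vD ≤ (s.uN : ℝ) / s.uD := by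
          rw [div_le_div_iff₀ hvD huD]; exact_mod_cast hsep'
        linarith
      rw [if_pos ⟨t, List.mem_cons_self, hω⟩, if_pos hω, if_neg hnone]; ring
    · rw [if_neg hω, zero_add]
      by_cases hex : ∃ s ∈ ts, ω ∈ s.toSet
      · obtain ⟨s, hs, hωs⟩ := hex
        rw [if_pos ⟨s, List.mem_cons_of_mem t hs, hωs⟩, if_pos ⟨s, hs, hωs⟩]
      · rw [if_neg hex, if_neg]
        rintro ⟨s, hs, hωs⟩
        rcases List.mem_cons.1 hs with rfl | hs'
        · exact hω hωs
        · exact hex ⟨s, hs', hωs⟩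

/-- A finite sum commutes with a list sum. [folklore] -/
private theorem sum_list_map_comm {α ι : Type*} (l : List α) (s : Finset ι) (g : α → ι → ℝ) :
    ∑ i ∈ s, (l.map fun a => g a i).sum = (l.map fun a => ∑ i ∈ s, g a i).sum := by
  induction l with
  | nil => simp
  | cons a l ih => simp only [List.map_cons, List.sum_cons, Finset.sum_add_distrib, ih]

/-- The well-formedness and separation of the rows of `Ω_E` and `Ω′_E` (decided by the kernel).
[cite: RhinViola2001, §5 p. 292] -/
theorem omegaRows_separated :
    (omegaRows.all Row.wf = true ∧ omegaRows.Pairwise Row.sep) ∧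
      (omegaRows'.all Row.wf = true ∧ omegaRows'.Pairwise Row.sep) := by
  refine ⟨⟨by decide, by decide⟩, ⟨by decide, by decide⟩⟩

/-! ### The block sum of a union of rows and its limit -/

open Classical in
/-- The `K`-block of a union of rows: `Σ_{p ≤ 19n prime, n < Kp} 𝟙[{n/p} ∈ ∪ rows] log p`. [folklore] -/
def blockSum (rows : List Row) (n K : ℕ) : ℝ :=
  ∑ p ∈ primesUpTo19 n,
    if (n : ℝ) < K * p then (if ∃ t ∈ rows, Int.fract ((n : ℝ) / p) ∈ t.toSet then (1 : ℝ) else 0) * Real.log p else 0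

/-- The partial sums `Σ_{k<K} (1/(k+u) − 1/(k+v))` of a row. [cite: RhinViola2001, §5 (5.14) (`∫ dψ`)] -/
def rowPartial (t : Row) (K : ℕ) : ℝ := ∑ i ∈ range K, (1 / ((i : ℝ) + t.lo) - 1 / ((i : ℝ) + t.hi))

open Classical in
/-- **The block sum is a combination of `ϑ`-blocks**, hence `blockSum/n → Σ_rows Σ_{k<K} (1/(k+u) − 1/(k+v))`. [folklore] -/
private theorem tendsto_blockSum_div (rows : List Row) (hwf : rows.all Row.wf = true) (hsep : rows.Pairwise Row.sep)
    (K : ℕ) : Tendsto (fun n : ℕ => blockSum rows n K / n) atTop (𝓝 (rows.map fun t => rowPartial t K).sum) := by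
  -- blockSum = Σ_rows (T_u − T_v)
  have hblock : ∀ n : ℕ, blockSum rows n K = (rows.map fun t =>
      (∑ i ∈ range K, (Chebyshev.theta (n / ((i : ℝ) + t.lo)) - Chebyshev.theta (n / ((i : ℝ) + 1)))) -
      (∑ i ∈ range K, (Chebyshev.theta (n / ((i : ℝ) + t.hi)) - Chebyshev.theta (n / ((i : ℝ) + 1))))).sum := by
    intro n
    have hrow : ∀ t ∈ rows,
        (∑ i ∈ range K, (Chebyshev.theta (n / ((i : ℝ) + t.lo)) - Chebyshev.theta (n / ((i : ℝ) + 1)))) -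
        (∑ i ∈ range K, (Chebyshev.theta (n / ((i : ℝ) + t.hi)) - Chebyshev.theta (n / ((i : ℝ) + 1)))) =
        ∑ p ∈ primesUpTo19 n,
          (if (n : ℝ) < K * p then (if Int.fract ((n : ℝ) / p) ∈ t.toSet then (1 : ℝ) else 0) * Real.log p else 0) := by
      intro t ht
      have hw := (List.all_eq_true.1 hwf) t ht
      obtain ⟨hlo0, hlo19, hle, hhi1⟩ := Row.wf_sound hw
      rw [blockT_eq n K hlo0 (lt_of_le_of_lt hle hhi1) hlo19,
        blockT_eq n K (lt_of_lt_of_le hlo0 hle) hhi1 (hlo19.trans (by linarith)), ← Finset.sum_sub_distrib]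
      refine Finset.sum_congr rfl fun p _ => ?_
      by_cases h : (n : ℝ) < K * p
      · rw [if_pos h, if_pos h, if_pos h, Row.indicator_eq hw]; ring
      · rw [if_neg h, if_neg h, if_neg h]; ring
    rw [List.map_congr_left hrow, blockSum, ← sum_list_map_comm]
    refine Finset.sum_congr rfl fun p _ => ?_
    by_cases h : (n : ℝ) < K * p
    · simp only [if_pos h]
      rw [indicator_union_eq_sum rows hwf hsep, ← List.sum_map_mul_right]
    · simp only [if_neg h, List.map_const', List.sum_replicate, smul_zero]
  simp only [hblock]
  have hlim : ∀ t ∈ rows, Tendsto (fun n : ℕ =>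
      ((∑ i ∈ range K, (Chebyshev.theta (n / ((i : ℝ) + t.lo)) - Chebyshev.theta (n / ((i : ℝ) + 1)))) -
      (∑ i ∈ range K, (Chebyshev.theta (n / ((i : ℝ) + t.hi)) - Chebyshev.theta (n / ((i : ℝ) + 1))))) / n)
      atTop (𝓝 (rowPartial t K)) := by
    intro t ht
    obtain ⟨hlo0, -, hle, -⟩ := Row.wf_sound ((List.all_eq_true.1 hwf) t ht)
    have h := (tendsto_blockT_div hlo0 K).sub (tendsto_blockT_div (lt_of_lt_of_le hlo0 hle) K)
    simp only [← sub_div] at h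
    convert h using 2
    rw [rowPartial, ← Finset.sum_sub_distrib]
    refine Finset.sum_congr rfl fun i _ => by ring
  refine (tendsto_list_sum rows hlim).congr fun n => ?_
  simp only [div_eq_mul_inv, List.sum_map_mul_right]


/-! ### The series `∫_{[u,v)} dψ = Σ_{k ≥ 0} (1/(k+u) − 1/(k+v))` -/

/-- The terms `1/(k+u) − 1/(k+v) = (v−u)/((k+u)(k+v))` of a well-formed row are non-negative, at most
`(v−u)/(u²(k+1)²)`, hence summable. [folklore] -/
private theorem rowTerm_summable {t : Row} (h : t.wf = true) :
    (∀ i : ℕ, 0 ≤ 1 / ((i : ℝ) + t.lo) - 1 / ((i : ℝ) + t.hi)) ∧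
      Summable (fun i : ℕ => 1 / ((i : ℝ) + t.lo) - 1 / ((i : ℝ) + t.hi)) := by
  obtain ⟨hlo0, -, hle, hhi1⟩ := Row.wf_sound h
  have hhi0 : 0 < t.hi := lt_of_lt_of_le hlo0 hle
  have hnn : ∀ i : ℕ, 0 ≤ 1 / ((i : ℝ) + t.lo) - 1 / ((i : ℝ) + t.hi) := fun i =>
    sub_nonneg.2 (one_div_le_one_div_of_le (by positivity) (by linarith))
  refine ⟨hnn, ?_⟩
  have hs : Summable fun i : ℕ => (t.hi - t.lo) / t.lo ^ 2 * (1 / ((i : ℝ) + 1) ^ 2) := by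
    have h := (summable_nat_add_iff 1).2 (Real.summable_one_div_nat_pow.2 one_lt_two)
    simpa using h.mul_left ((t.hi - t.lo) / t.lo ^ 2)
  refine Summable.of_nonneg_of_le hnn (fun i => ?_) hs
  have hi : (0 : ℝ) ≤ i := i.cast_nonneg
  have h1 : (0 : ℝ) < (i : ℝ) + t.lo := by linarith
  have h2 : (0 : ℝ) < (i : ℝ) + t.hi := by linarith
  rw [div_sub_div _ _ h1.ne' h2.ne']
  have hnum : 1 * ((i : ℝ) + t.hi) - ((i : ℝ) + t.lo) * 1 = t.hi - t.lo := by ring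
  rw [hnum, div_mul_div_comm, mul_one, div_le_div_iff₀ (by positivity) (by positivity)]
  have hlt : (t.lo * ((i : ℝ) + 1)) ^ 2 ≤ ((i : ℝ) + t.lo) * ((i : ℝ) + t.hi) := by
    have h3 : t.lo * ((i : ℝ) + 1) ≤ (i : ℝ) + t.lo := by nlinarith
    calc (t.lo * ((i : ℝ) + 1)) ^ 2 ≤ ((i : ℝ) + t.lo) ^ 2 := by gcongr
      _ = ((i : ℝ) + t.lo) * ((i : ℝ) + t.lo) := sq _
      _ ≤ ((i : ℝ) + t.lo) * ((i : ℝ) + t.hi) := by gcongr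
  have h3 : 0 ≤ t.hi - t.lo := by linarith
  calc (t.hi - t.lo) * (t.lo ^ 2 * ((i : ℝ) + 1) ^ 2) = (t.hi - t.lo) * (t.lo * ((i : ℝ) + 1)) ^ 2 := by ring
    _ ≤ (t.hi - t.lo) * (((i : ℝ) + t.lo) * ((i : ℝ) + t.hi)) := by gcongr

/-- **`∫_{[u,v)} dψ = ψ(v) − ψ(u) = Σ_{k ≥ 0} (1/(k+u) − 1/(k+v))`**, the contribution of one row to (5.14)
(`ψ = Γ′/Γ`; the series is the standard one for a difference of digamma values). [cite: RhinViola2001, §5 (5.14)] -/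
def rowSeries (t : Row) : ℝ := ∑' i : ℕ, (1 / ((i : ℝ) + t.lo) - 1 / ((i : ℝ) + t.hi))

/-- **`∫_Ω dψ`** for a union `Ω` of disjoint rows: the sum of the row series. [cite: RhinViola2001, §5 (5.14)] -/
def intDpsi (rows : List Row) : ℝ := (rows.map rowSeries).sum

/-- The partial sums converge: `Σ_rows Σ_{k<K} (…) → ∫_Ω dψ` as `K → ∞`. [folklore] -/
private theorem tendsto_rowPartial_sum (rows : List Row) (hwf : rows.all Row.wf = true) :
    Tendsto (fun K : ℕ => (rows.map fun t => rowPartial t K).sum) atTop (𝓝 (intDpsi rows)) := by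
  unfold intDpsi
  exact tendsto_list_sum rows fun t ht =>
    (rowTerm_summable ((List.all_eq_true.1 hwf) t ht)).2.tendsto_sum_tsum_nat

/-! ### `log Δ_n` between the block sums, and the limits -/

open Classical in
/-- `log ∏_{p > √(19n), {n/p} ∈ Ω} p` as a sum over the primes `p ≤ 19n`. [folklore] -/
def logProd (rows : List Row) (n : ℕ) : ℝ :=
  ∑ p ∈ primesUpTo19 n,
    if 19 * n < p ^ 2 ∧ ∃ t ∈ rows, Int.fract ((n : ℝ) / p) ∈ t.toSet then Real.log p else 0

open Classical in
/-- **Sandwich** for `K ≥ 1`, `n ≥ 19K²`: `blockSum ≤ logProd ≤ blockSum + ϑ(n/K)` (the primes `√(19n) < p ≤ n/K` contribute at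
most `ϑ(n/K)`). [folklore] -/
private theorem sandwich (rows : List Row) (n K : ℕ) (hK : 1 ≤ K) (hn : 19 * K ^ 2 ≤ n) :
    blockSum rows n K ≤ logProd rows n ∧
      logProd rows n ≤ blockSum rows n K + Chebyshev.theta (n / K) := by
  have hn0 : (0 : ℝ) ≤ n := n.cast_nonneg
  have hK0 : (0 : ℝ) < K := by exact_mod_cast hK
  have hKn : (19 : ℝ) * K ^ 2 ≤ n := by exact_mod_cast hn
  have hlog0 : ∀ p : ℕ, 0 ≤ Real.log p := fun p => Real.log_natCast_nonneg p
  -- `n < Kp ⇒ 19n < p²`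
  have hsq : ∀ p : ℕ, (n : ℝ) < K * p → 19 * n < p ^ 2 := by
    intro p hp
    have hp19 : (19 : ℝ) * K < p := by nlinarith
    have : (19 : ℝ) * n < (p : ℝ) ^ 2 := by nlinarith
    exact_mod_cast this
  constructor
  · unfold blockSum logProd
    refine Finset.sum_le_sum fun p _ => ?_
    by_cases h : (n : ℝ) < K * p
    · rw [if_pos h]
      by_cases hex : ∃ t ∈ rows, Int.fract ((n : ℝ) / p) ∈ t.toSet
      · rw [if_pos hex, if_pos ⟨hsq p h, hex⟩, one_mul]
      · rw [if_neg hex, zero_mul]; split_ifs <;> simp [hlog0]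
    · rw [if_neg h]; split_ifs <;> simp [hlog0]
  · have hθ : Chebyshev.theta (n / K) = ∑ p ∈ primesUpTo19 n, if (p : ℝ) ≤ n / K then Real.log p else 0 :=
      theta_eq_sum_ite n (by positivity) ((div_le_self hn0 (by exact_mod_cast hK)).trans (by nlinarith))
    rw [hθ, blockSum, logProd, ← Finset.sum_add_distrib]
    refine Finset.sum_le_sum fun p hp => ?_
    obtain ⟨⟨hp0, -⟩, -⟩ : (0 < p ∧ p ≤ 19 * n) ∧ p.Prime := by simpa [primesUpTo19, mem_filter, mem_Ioc] using hp
    have hpr : (0 : ℝ) < p := by exact_mod_cast hp0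
    by_cases h : (n : ℝ) < K * p
    · rw [if_pos h]
      by_cases hex : ∃ t ∈ rows, Int.fract ((n : ℝ) / p) ∈ t.toSet
      · rw [if_pos hex, one_mul]; split_ifs <;> linarith [hlog0 p]
      · rw [if_neg hex, if_neg (fun h' => hex h'.2), zero_mul]; split_ifs <;> linarith [hlog0 p]
    · have hle : (p : ℝ) ≤ n / K := by rw [le_div_iff₀ hK0]; linarith
      rw [if_neg h, if_pos hle, zero_add]; split_ifs <;> linarith [hlog0 p]

/-- **The limit of `(1/n) log ∏_{p > √(19n), {n/p} ∈ Ω} p` is `∫_Ω dψ`**, for a union `Ω` of well-formed, separated rows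
(prime number theorem). [cite: RhinViola2001, §5 (5.14); RhinViola1996, §4 p. 51] -/
theorem tendsto_logProd_div (rows : List Row) (hwf : rows.all Row.wf = true) (hsep : rows.Pairwise Row.sep) :
    Tendsto (fun n : ℕ => logProd rows n / n) atTop (𝓝 (intDpsi rows)) := by
  rw [Metric.tendsto_atTop]
  intro ε hε
  have hε3 : 0 < ε / 3 := by positivity
  have hP := tendsto_rowPartial_sum rows hwf
  have hlim0 : Tendsto (fun K : ℕ => Real.log 4 / (K : ℝ)) atTop (𝓝 0) :=
    tendsto_const_nhds.div_atTop tendsto_natCast_atTop_atTop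
  obtain ⟨K, ⟨hK1, hK2⟩, hK3⟩ :=
    ((((Metric.tendsto_nhds.1 hP) (ε / 3) hε3).and (hlim0.eventually (gt_mem_nhds hε3))).and
      (eventually_ge_atTop 1)).exists
  rw [Real.dist_eq] at hK1
  obtain ⟨N₁, hN₁⟩ := Metric.tendsto_atTop.1 (tendsto_blockSum_div rows hwf hsep K) (ε / 3) hε3
  refine ⟨max N₁ (19 * K ^ 2 + 1), fun n hn => ?_⟩
  have hn2 : 19 * K ^ 2 ≤ n := by have := le_of_max_le_right hn; omega
  have hn' : (0 : ℝ) < n := by exact_mod_cast (show 0 < n by have := le_of_max_le_right hn; omega)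
  have hK0 : (0 : ℝ) < K := by exact_mod_cast hK3
  obtain ⟨hlo, hhi⟩ := sandwich rows n K hK3 hn2
  have hθ : Chebyshev.theta (n / K) ≤ Real.log 4 * (n / K) := Chebyshev.theta_le_log4_mul_x (by positivity)
  specialize hN₁ n (le_of_max_le_left hn)
  rw [Real.dist_eq] at hN₁ ⊢
  have e1 : |logProd rows n / n - blockSum rows n K / n| ≤ Real.log 4 / K := by
    rw [← sub_div, abs_div, abs_of_pos hn', div_le_iff₀ hn', abs_of_nonneg (by linarith)]
    calc logProd rows n - blockSum rows n K ≤ Real.log 4 * (n / K) := by linarith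
      _ = Real.log 4 / K * n := by field_simp
  calc |logProd rows n / n - intDpsi rows|
      ≤ |logProd rows n / n - blockSum rows n K / n| + |blockSum rows n K / n - (rows.map fun t => rowPartial t K).sum| +
          |(rows.map fun t => rowPartial t K).sum - intDpsi rows| := by
        linarith [abs_sub_le (logProd rows n / n) (blockSum rows n K / n) (intDpsi rows),
          abs_sub_le (blockSum rows n K / n) ((rows.map fun t => rowPartial t K).sum) (intDpsi rows)]
    _ < ε / 3 + ε / 3 + ε / 3 := by linarith
    _ = ε := by ring

/-- `{n/p} = (n mod p)/p`. [folklore] -/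
private theorem fract_eq_mod_div (n p : ℕ) : Int.fract ((n : ℝ) / p) = ((n % p : ℕ) : ℝ) / p :=
  Int.fract_div_natCast_eq_div_natCast_mod

open Classical in
/-- `log Δ_n = logProd Ω_E`. [cite: RhinViola2001, §5 p. 290 (definition of `Δ_n`)] -/
private theorem log_Delta_eq (n : ℕ) : Real.log (Delta n) = logProd omegaRows n := by
  rw [Delta, Nat.cast_prod, Real.log_prod fun p hp =>
    Nat.cast_ne_zero.2 (mem_omegaPrimes.1 hp).1.ne_zero]
  unfold logProd
  rw [← Finset.sum_filter]
  refine Finset.sum_congr ?_ fun _ _ => rfl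
  ext p
  simp only [primesUpTo19, mem_filter, mem_Ioc, mem_omegaPrimes, omegaE, Set.mem_setOf_eq, fract_eq_mod_div]
  constructor
  · rintro ⟨hp, hsq, hω⟩; exact ⟨⟨⟨hp.pos, le_of_mem_omegaE hp.pos hω⟩, hp⟩, hsq, hω⟩
  · rintro ⟨⟨-, hp⟩, hsq, hω⟩; exact ⟨hp, hsq, hω⟩

open Classical in
/-- `log Δ′_n = logProd Ω′_E`. [cite: RhinViola2001, §5 p. 290 (definition of `Δ′_n`)] -/
private theorem log_Delta'_eq (n : ℕ) : Real.log (Delta' n) = logProd omegaRows' n := by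
  rw [Delta', Nat.cast_prod, Real.log_prod fun p hp =>
    Nat.cast_ne_zero.2 (mem_omegaPrimes'.1 hp).1.ne_zero]
  unfold logProd
  rw [← Finset.sum_filter]
  refine Finset.sum_congr ?_ fun _ _ => rfl
  ext p
  simp only [primesUpTo19, mem_filter, mem_Ioc, mem_omegaPrimes', omegaE', Set.mem_setOf_eq, fract_eq_mod_div]
  constructor
  · rintro ⟨hp, hsq, hω⟩
    exact ⟨⟨⟨hp.pos, (le_of_mem_omegaE' hp.pos hω).trans (by omega)⟩, hp⟩, hsq, hω⟩
  · rintro ⟨⟨-, hp⟩, hsq, hω⟩; exact ⟨hp, hsq, hω⟩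

/-- **`lim (1/n) log Δ_n = ∫_{Ω_E} dψ`** (record parameters). [cite: RhinViola2001, §5 (5.14); RhinViola1996, §4 p. 51] -/
theorem tendsto_log_Delta_div :
    Tendsto (fun n : ℕ => Real.log (Delta n) / n) atTop (𝓝 (intDpsi omegaRows)) := by
  simp only [log_Delta_eq]
  exact tendsto_logProd_div omegaRows omegaRows_separated.1.1 omegaRows_separated.1.2

/-- **`lim (1/n) log Δ′_n = ∫_{Ω′_E} dψ`** (record parameters). [cite: RhinViola2001, §5 (5.14); RhinViola1996, §4 p. 51] -/
theorem tendsto_log_Delta'_div :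
    Tendsto (fun n : ℕ => Real.log (Delta' n) / n) atTop (𝓝 (intDpsi omegaRows')) := by
  simp only [log_Delta'_eq]
  exact tendsto_logProd_div omegaRows' omegaRows_separated.2.1 omegaRows_separated.2.2

/-- `log d_{cn}/n → c` (`log d_m ~ m`, prime number theorem; tree: `tendsto_log_lcmUpto_div`). [folklore] -/
private theorem tendsto_log_d_div (c : ℕ) (hc : 0 < c) :
    Tendsto (fun n : ℕ => Real.log (d ((n : ℤ) * c)) / n) atTop (𝓝 (c : ℝ)) := by
  have hd : ∀ n : ℕ, d ((n : ℤ) * c) = Nat.lcmUpto (c * n) := fun n => by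
    rw [show ((n : ℤ) * c) = ((c * n : ℕ) : ℤ) by push_cast; ring, d, Int.toNat_natCast]
  have hmul : Tendsto (fun n : ℕ => c * n) atTop atTop :=
    tendsto_atTop_mono (fun n => Nat.le_mul_of_pos_left n hc) tendsto_id
  have h := (Literature.NumberTheory.Transcendental.tendsto_log_lcmUpto_div.comp hmul).mul_const (c : ℝ)
  rw [one_mul] at h
  refine h.congr' ?_
  filter_upwards [eventually_gt_atTop 0] with n hn
  have hn' : (0 : ℝ) < n := by exact_mod_cast hn
  have hc' : (0 : ℝ) < c := by exact_mod_cast hc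
  simp only [Function.comp_def, hd]
  push_cast
  field_simp

/-- **(5.14)**: `lim_{n→∞} (1/n) log D_n = M + N + Q − (∫_{Ω_E} dψ + ∫_{Ω′_E} dψ)` with `M + N + Q = 54` (record parameters;
`∫ dψ` = the row series `intDpsi`). [cite: RhinViola2001, §5 (5.14)] -/
theorem tendsto_log_bigD_div :
    Tendsto (fun n : ℕ => Real.log (bigD n) / n) atTop (𝓝 (54 - (intDpsi omegaRows + intDpsi omegaRows'))) := by
  have h := (((tendsto_log_d_div 19 (by norm_num)).add (tendsto_log_d_div 18 (by norm_num))).add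
    (tendsto_log_d_div 17 (by norm_num))).sub (tendsto_log_Delta_div.add tendsto_log_Delta'_div)
  have h54 : ((19 : ℕ) : ℝ) + ((18 : ℕ) : ℝ) + ((17 : ℕ) : ℝ) - (intDpsi omegaRows + intDpsi omegaRows') =
      54 - (intDpsi omegaRows + intDpsi omegaRows') := by norm_num
  rw [h54] at h
  refine h.congr fun n => ?_
  have hD := bigD_mul_Delta n
  have hΔ := Delta_pos n
  have hΔ' := Delta'_pos n
  have hd19 : 0 < d ((n : ℤ) * 19) := Nat.lcmUpto_pos _
  have hd18 : 0 < d ((n : ℤ) * 18) := Nat.lcmUpto_pos _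
  have hd17 : 0 < d ((n : ℤ) * 17) := Nat.lcmUpto_pos _
  have hB : 0 < bigD n := by
    rcases Nat.eq_zero_or_pos (bigD n) with h0 | h0
    · rw [h0, zero_mul] at hD; exact absurd hD (by positivity)
    · exact h0
  have hlog : Real.log (bigD n) = Real.log (d ((n : ℤ) * 19)) + Real.log (d ((n : ℤ) * 18)) + Real.log (d ((n : ℤ) * 17)) -
      (Real.log (Delta n) + Real.log (Delta' n)) := by
    have hR : (bigD n : ℝ) * ((Delta n : ℝ) * (Delta' n : ℝ)) =
        (d ((n : ℤ) * 19) : ℝ) * (d ((n : ℤ) * 18) : ℝ) * (d ((n : ℤ) * 17) : ℝ) := by exact_mod_cast hD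
    have := congrArg Real.log hR
    rw [Real.log_mul (by positivity) (by positivity), Real.log_mul (by positivity) (by positivity),
      Real.log_mul (by positivity) (by positivity), Real.log_mul (by positivity) (by positivity)] at this
    linarith
  rw [hlog]
  push_cast
  ring


/-! ### Two-decimal windows for `∫_{Ω_E} dψ`, `∫_{Ω′_E} dψ` and `c₂` -/

/-- **Window for one row**: `K` terms plus the telescoping tail bounds
`(v−u)/(K+v) ≤ Σ_{k ≥ K} (v−u)/((k+u)(k+v)) ≤ (v−u)/(K−1+v)` (`K ≥ 1`). [folklore] -/
private theorem rowSeries_window {t : Row} (h : t.wf = true) (K : ℕ) (hK : 1 ≤ K) :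
    rowPartial t K + (t.hi - t.lo) / (K + t.hi) ≤ rowSeries t ∧
      rowSeries t ≤ rowPartial t K + (t.hi - t.lo) / (K - 1 + t.hi) := by
  obtain ⟨hlo0, -, hle, hhi1⟩ := Row.wf_sound h
  obtain ⟨h0, hsum⟩ := rowTerm_summable h
  have hhi0 : 0 < t.hi := lt_of_lt_of_le hlo0 hle
  have hK1 : (1 : ℝ) ≤ K := by exact_mod_cast hK
  set f : ℕ → ℝ := fun i => 1 / ((i : ℝ) + t.lo) - 1 / ((i : ℝ) + t.hi) with hf
  have hsumK : Summable fun i => f (i + K) := (summable_nat_add_iff K).2 hsum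
  have hsplit : rowSeries t = rowPartial t K + ∑' i, f (i + K) := by
    rw [rowSeries, rowPartial, ← hsum.sum_add_tsum_nat_add K]
  have hfK : ∀ i : ℕ, f (i + K) = (t.hi - t.lo) / (((i : ℝ) + K + t.lo) * ((i : ℝ) + K + t.hi)) := by
    intro i
    have h1 : (0 : ℝ) < (i : ℝ) + K + t.lo := by linarith [i.cast_nonneg (α := ℝ)]
    have h2 : (0 : ℝ) < (i : ℝ) + K + t.hi := by linarith [i.cast_nonneg (α := ℝ)]
    simp only [hf, Nat.cast_add]
    rw [div_sub_div _ _ h1.ne' h2.ne']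
    exact congrArg₂ (· / ·) (by ring) rfl
  -- telescoping comparison sequences `w_c i = (v−u)/(i + K + c)`, `c = v` (lower) and `c = v − 1` (upper)
  set w : ℝ → ℕ → ℝ := fun c i => (t.hi - t.lo) / ((i : ℝ) + K + c) with hw
  have hstep : ∀ c : ℝ, 0 < K + c → ∀ i : ℕ,
      w c i - w c (i + 1) = (t.hi - t.lo) / (((i : ℝ) + K + c) * ((i : ℝ) + K + c + 1)) := by
    intro c hc i
    have hi : (0 : ℝ) ≤ i := i.cast_nonneg
    simp only [hw, Nat.cast_add, Nat.cast_one]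
    rw [div_sub_div _ _ (by linarith) (by linarith)]
    exact congrArg₂ (· / ·) (by ring) (by ring)
  have htel : ∀ c : ℝ, ∀ n : ℕ, ∑ i ∈ range n, (w c i - w c (i + 1)) = w c 0 - w c n := fun c n =>
    Finset.sum_range_sub' _ n
  have hlim : ∀ c : ℝ, Tendsto (fun n : ℕ => w c 0 - w c n) atTop (𝓝 (w c 0)) := by
    intro c
    have h1 : Tendsto (fun n : ℕ => w c n) atTop (𝓝 0) := by
      simp only [hw]
      refine tendsto_const_nhds.div_atTop ?_
      exact tendsto_atTop_add_const_right _ _ (tendsto_atTop_add_const_right _ _ tendsto_natCast_atTop_atTop)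
    simpa using tendsto_const_nhds.sub h1
  have hvu : 0 ≤ t.hi - t.lo := by linarith
  rw [hsplit]
  constructor
  · -- lower: `w_v i − w_v (i+1) ≤ f (i+K)`, and the partial sums of the left telescope to `w_v 0 − w_v n → w_v 0`
    have hle' : ∀ i : ℕ, w t.hi i - w t.hi (i + 1) ≤ f (i + K) := by
      intro i
      have hi : (0 : ℝ) ≤ i := i.cast_nonneg
      rw [hstep t.hi (by linarith) i, hfK i]
      apply div_le_div_of_nonneg_left hvu (by apply mul_pos <;> linarith)
      have : (i : ℝ) + K + t.lo ≤ (i : ℝ) + K + t.hi + 1 := by linarith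
      exact mul_le_mul this le_rfl (by linarith) (by linarith) |>.trans_eq (by ring)
    have hpart : ∀ n : ℕ, w t.hi 0 - w t.hi n ≤ ∑' i, f (i + K) := fun n =>
      (htel t.hi n).symm.le.trans ((sum_le_sum fun i _ => hle' i).trans
        (hsumK.sum_le_tsum (range n) fun i _ => h0 _))
    have hw0 : w t.hi 0 = (t.hi - t.lo) / (K + t.hi) := by simp [hw]
    have := le_of_tendsto' (hlim t.hi) hpart
    rw [hw0] at this
    linarith
  · -- upper: `f (i+K) ≤ w_{v−1} i − w_{v−1} (i+1)`
    have hle' : ∀ i : ℕ, f (i + K) ≤ w (t.hi - 1) i - w (t.hi - 1) (i + 1) := by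
      intro i
      have hi : (0 : ℝ) ≤ i := i.cast_nonneg
      rw [hstep (t.hi - 1) (by linarith) i, hfK i]
      apply div_le_div_of_nonneg_left hvu (by apply mul_pos <;> linarith)
      have h1 : (i : ℝ) + K + (t.hi - 1) ≤ (i : ℝ) + K + t.lo := by linarith
      have h2 : (i : ℝ) + K + (t.hi - 1) + 1 = (i : ℝ) + K + t.hi := by ring
      rw [h2]
      exact mul_le_mul h1 le_rfl (by linarith) (by linarith)
    have hw0 : w (t.hi - 1) 0 = (t.hi - t.lo) / (K - 1 + t.hi) := by
      simp only [hw, Nat.cast_zero, zero_add]; exact congrArg₂ (· / ·) rfl (by ring)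
    have hup : ∑' i, f (i + K) ≤ w (t.hi - 1) 0 := by
      refine Real.tsum_le_of_sum_range_le (fun i => h0 _) fun n => ?_
      calc ∑ i ∈ range n, f (i + K) ≤ ∑ i ∈ range n, (w (t.hi - 1) i - w (t.hi - 1) (i + 1)) :=
            sum_le_sum fun i _ => hle' i
        _ = w (t.hi - 1) 0 - w (t.hi - 1) n := htel _ n
        _ ≤ w (t.hi - 1) 0 := sub_le_self _ (by
            simp only [hw]; exact div_nonneg hvu (by have : (0:ℝ) ≤ n := n.cast_nonneg; linarith))
    rw [hw0] at hup
    linarith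

/-- Windows add up over the rows of a well-formed union. [folklore] -/
private theorem intDpsi_window (rows : List Row) (hwf : rows.all Row.wf = true) (K : ℕ) (hK : 1 ≤ K) :
    (rows.map fun t => rowPartial t K + (t.hi - t.lo) / (K + t.hi)).sum ≤ intDpsi rows ∧
      intDpsi rows ≤ (rows.map fun t => rowPartial t K + (t.hi - t.lo) / (K - 1 + t.hi)).sum := by
  induction rows with
  | nil => simp [intDpsi]
  | cons t ts ih =>
    simp only [List.all_cons, Bool.and_eq_true] at hwf
    obtain ⟨ih1, ih2⟩ := ih hwf.2
    obtain ⟨h1, h2⟩ := rowSeries_window hwf.1 K hK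
    simp only [intDpsi, List.map_cons, List.sum_cons] at ih1 ih2 ⊢
    exact ⟨by linarith, by linarith⟩

/-- **`∫_{Ω_E} dψ = 18.04470204…`: the window `18.04 < ∫_{Ω_E} dψ < 18.05`** (twelve terms of each row series and the
telescoping tail bounds, exact rational arithmetic). [cite: RhinViola2001, §5 p. 292 (`∫_{Ω_E} dψ(x) = 18.04470204…`)] -/
theorem intDpsi_omegaRows_window : 18.04 < intDpsi omegaRows ∧ intDpsi omegaRows < 18.05 := by
  obtain ⟨h1, h2⟩ := intDpsi_window omegaRows omegaRows_separated.1.1 12 (by norm_num)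
  set X := intDpsi omegaRows with hX
  simp only [omegaRows, List.map_cons, List.map_nil, List.sum_cons, List.sum_nil, rowPartial, Row.lo, Row.hi,
    Finset.sum_range_succ, Finset.sum_range_zero, Nat.cast_ofNat] at h1 h2
  norm_num at h1 h2
  constructor <;> linarith

/-- **`∫_{Ω′_E} dψ = 6.14298325…`: the window `6.14 < ∫_{Ω′_E} dψ < 6.15`**. [cite: RhinViola2001, §5 p. 292
(`∫_{Ω′_E} dψ(x) = 6.14298325…`)] -/
theorem intDpsi_omegaRows'_window : 6.14 < intDpsi omegaRows' ∧ intDpsi omegaRows' < 6.15 := by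
  obtain ⟨h1, h2⟩ := intDpsi_window omegaRows' omegaRows_separated.2.1 12 (by norm_num)
  set X := intDpsi omegaRows' with hX
  simp only [omegaRows', List.map_cons, List.map_nil, List.sum_cons, List.sum_nil, rowPartial, Row.lo, Row.hi,
    Finset.sum_range_succ, Finset.sum_range_zero, Nat.cast_ofNat] at h1 h2
  norm_num at h1 h2
  constructor <;> linarith

/-- **"so that `c₂ = 29.81231469…`"**: the limit (5.14) of `(1/n) log D_n` lies in `(29.80, 29.82)`.
[cite: RhinViola2001, §5 p. 293 (`c₂ = 29.81231469…`)] -/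
theorem c2_window : 29.80 < 54 - (intDpsi omegaRows + intDpsi omegaRows') ∧
    54 - (intDpsi omegaRows + intDpsi omegaRows') < 29.82 := by
  obtain ⟨h1, h2⟩ := intDpsi_omegaRows_window
  obtain ⟨h3, h4⟩ := intDpsi_omegaRows'_window
  constructor <;> linarith


/-! ### Sharp numerics I: `∫ dψ` to `10⁻⁶` by second-order telescoping tails, evaluated exactly over `ℚ` -/

/-- The marks of a row over `ℚ`. [folklore] -/
def Row.loQ (t : Row) : ℚ := (t.uN : ℚ) / t.uD

/-- The marks of a row over `ℚ`. [folklore] -/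
def Row.hiQ (t : Row) : ℚ := (t.vN : ℚ) / t.vD

/-- The partial sums of a row over `ℚ`. [folklore] -/
def rowPartialQ (t : Row) (K : ℕ) : ℚ := ∑ i ∈ Finset.range K, (1 / ((i : ℚ) + t.loQ) - 1 / ((i : ℚ) + t.hiQ))

/-- The second-order tail parameter `c' = c + d/(2K)`, `c = (u+v−1)/2`, `d = uv − c(c+1)`, for which
`(i+K+u)(i+K+v) ≤ (i+K+c')(i+K+c'+1)` for all `i ≥ 0`, whence `Σ_{k ≥ K} (v−u)/((k+u)(k+v)) ≥ (v−u)/(K+c')`. [folklore] -/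
def Row.cQ (t : Row) (K : ℕ) : ℚ :=
  (t.loQ + t.hiQ - 1) / 2 + (t.loQ * t.hiQ - (t.loQ + t.hiQ - 1) / 2 * ((t.loQ + t.hiQ - 1) / 2 + 1)) / (2 * K)

/-- The second-order lower bound of a row series over `ℚ`: `K` terms `+ (v−u)/(K+c')`. [folklore] -/
def rowLowerQ (t : Row) (K : ℕ) : ℚ := rowPartialQ t K + (t.hiQ - t.loQ) / (K + t.cQ K)

/-- The (decidable) hypotheses of the second-order tail bound for a row. [folklore] -/
def rowLowerCheck (t : Row) (K : ℕ) : Bool :=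
  decide (0 < (K : ℚ) + t.cQ K) && decide (t.loQ + t.hiQ ≤ 2 * t.cQ K + 1) &&
    decide (((K : ℚ) + t.loQ) * (K + t.hiQ) ≤ (K + t.cQ K) * (K + t.cQ K + 1))

/-- `u` is the cast of its `ℚ` mirror. [folklore] -/
private theorem Row.lo_eq_cast (t : Row) : t.lo = ((t.loQ : ℚ) : ℝ) := by
  simp only [Row.lo, Row.loQ]; push_cast; rfl

/-- `v` is the cast of its `ℚ` mirror. [folklore] -/
private theorem Row.hi_eq_cast (t : Row) : t.hi = ((t.hiQ : ℚ) : ℝ) := by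
  simp only [Row.hi, Row.hiQ]; push_cast; rfl

/-- The partial sums are the casts of their `ℚ` mirrors. [folklore] -/
private theorem rowPartial_eq_cast (t : Row) (K : ℕ) : rowPartial t K = ((rowPartialQ t K : ℚ) : ℝ) := by
  simp only [rowPartial, rowPartialQ, Row.lo_eq_cast, Row.hi_eq_cast]; push_cast; rfl

/-- **Second-order lower tail bound**: if `u + v ≤ 2c' + 1` and `(K+u)(K+v) ≤ (K+c')(K+c'+1)` (`K + c' > 0`) then
`(i+K+u)(i+K+v) ≤ (i+K+c')(i+K+c'+1)` for all `i`, hence `Σ_{k<K} (…) + (v−u)/(K+c') ≤ Σ_{k ≥ 0} (1/(k+u) − 1/(k+v))`.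
[folklore] -/
private theorem rowSeries_lower_of {t : Row} (h : t.wf = true) (K : ℕ) {c' : ℝ} (h0 : 0 < (K : ℝ) + c')
    (hslope : t.lo + t.hi ≤ 2 * c' + 1) (hint : ((K : ℝ) + t.lo) * (K + t.hi) ≤ (K + c') * (K + c' + 1)) :
    rowPartial t K + (t.hi - t.lo) / (K + c') ≤ rowSeries t := by
  obtain ⟨hlo0, -, hle, hhi1⟩ := Row.wf_sound h
  obtain ⟨h0f, hsum⟩ := rowTerm_summable h
  set f : ℕ → ℝ := fun i => 1 / ((i : ℝ) + t.lo) - 1 / ((i : ℝ) + t.hi) with hf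
  have hsumK : Summable fun i => f (i + K) := (summable_nat_add_iff K).2 hsum
  have hsplit : rowSeries t = rowPartial t K + ∑' i, f (i + K) := by
    rw [rowSeries, rowPartial, ← hsum.sum_add_tsum_nat_add K]
  have hfK : ∀ i : ℕ, f (i + K) = (t.hi - t.lo) / (((i : ℝ) + K + t.lo) * ((i : ℝ) + K + t.hi)) := by
    intro i
    have h1 : (0 : ℝ) < (i : ℝ) + K + t.lo := by linarith [i.cast_nonneg (α := ℝ), K.cast_nonneg (α := ℝ)]
    have h2 : (0 : ℝ) < (i : ℝ) + K + t.hi := by linarith [i.cast_nonneg (α := ℝ), K.cast_nonneg (α := ℝ)]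
    simp only [hf, Nat.cast_add]
    rw [div_sub_div _ _ h1.ne' h2.ne']
    exact congrArg₂ (· / ·) (by ring) rfl
  -- comparison `w i − w (i+1) ≤ f (i+K)` with `w i = (v−u)/(i+K+c')`
  set w : ℕ → ℝ := fun i => (t.hi - t.lo) / ((i : ℝ) + K + c') with hw
  have hvu : 0 ≤ t.hi - t.lo := by linarith
  have hle' : ∀ i : ℕ, w i - w (i + 1) ≤ f (i + K) := by
    intro i
    have hi : (0 : ℝ) ≤ i := i.cast_nonneg
    have hp1 : (0 : ℝ) < (i : ℝ) + K + c' := by linarith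
    have hstep : w i - w (i + 1) = (t.hi - t.lo) / (((i : ℝ) + K + c') * ((i : ℝ) + K + c' + 1)) := by
      simp only [hw, Nat.cast_add, Nat.cast_one]
      rw [div_sub_div _ _ hp1.ne' (by linarith)]
      exact congrArg₂ (· / ·) (by ring) (by ring)
    rw [hstep, hfK i]
    apply div_le_div_of_nonneg_left hvu (by apply mul_pos <;> linarith [K.cast_nonneg (α := ℝ)])
    -- `(i+K+u)(i+K+v) ≤ (i+K+c')(i+K+c'+1)`: linear in `i` with non-negative slope and intercept
    have key : ((i : ℝ) + K + c') * ((i : ℝ) + K + c' + 1) - ((i : ℝ) + K + t.lo) * ((i : ℝ) + K + t.hi) =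
        (2 * c' + 1 - t.lo - t.hi) * i + (((K : ℝ) + c') * (K + c' + 1) - ((K : ℝ) + t.lo) * (K + t.hi)) := by
      ring
    nlinarith [mul_nonneg (by linarith : (0 : ℝ) ≤ 2 * c' + 1 - t.lo - t.hi) hi]
  have htel : ∀ n : ℕ, ∑ i ∈ Finset.range n, (w i - w (i + 1)) = w 0 - w n := fun n => Finset.sum_range_sub' _ n
  have hlim : Tendsto (fun n : ℕ => w 0 - w n) atTop (𝓝 (w 0)) := by
    have h1 : Tendsto (fun n : ℕ => w n) atTop (𝓝 0) := by
      simp only [hw]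
      refine tendsto_const_nhds.div_atTop ?_
      exact tendsto_atTop_add_const_right _ _ (tendsto_atTop_add_const_right _ _ tendsto_natCast_atTop_atTop)
    simpa using tendsto_const_nhds.sub h1
  have hpart : ∀ n : ℕ, w 0 - w n ≤ ∑' i, f (i + K) := fun n =>
    (htel n).symm.le.trans ((Finset.sum_le_sum fun i _ => hle' i).trans
      (hsumK.sum_le_tsum (Finset.range n) fun i _ => h0f _))
  have hw0 : w 0 = (t.hi - t.lo) / (K + c') := by simp [hw]
  have := le_of_tendsto' hlim hpart
  rw [hw0] at this
  rw [hsplit]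
  linarith

/-- The second-order lower bound of a certified row, cast from `ℚ`. [folklore] -/
private theorem rowLowerQ_le {t : Row} (h : t.wf = true) (K : ℕ) (hc : rowLowerCheck t K = true) :
    ((rowLowerQ t K : ℚ) : ℝ) ≤ rowSeries t := by
  simp only [rowLowerCheck, Bool.and_eq_true, decide_eq_true_eq] at hc
  obtain ⟨⟨h0, hslope⟩, hint⟩ := hc
  have h0' : (0 : ℝ) < (K : ℝ) + ((t.cQ K : ℚ) : ℝ) := by exact_mod_cast h0
  have hslope' : t.lo + t.hi ≤ 2 * ((t.cQ K : ℚ) : ℝ) + 1 := by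
    rw [Row.lo_eq_cast, Row.hi_eq_cast]; exact_mod_cast hslope
  have hint' : ((K : ℝ) + t.lo) * (K + t.hi) ≤ (K + ((t.cQ K : ℚ) : ℝ)) * (K + ((t.cQ K : ℚ) : ℝ) + 1) := by
    rw [Row.lo_eq_cast, Row.hi_eq_cast]; exact_mod_cast hint
  have h := rowSeries_lower_of h K h0' hslope' hint'
  rw [rowPartial_eq_cast, Row.lo_eq_cast, Row.hi_eq_cast] at h
  simp only [rowLowerQ]; push_cast
  exact h

/-- The certified lower bounds add up over the rows. [folklore] -/
private theorem lowerSumQ_le (rows : List Row) (hwf : rows.all Row.wf = true) (K : ℕ)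
    (hc : rows.all (fun t => rowLowerCheck t K) = true) :
    (((rows.map fun t => rowLowerQ t K).sum : ℚ) : ℝ) ≤ intDpsi rows := by
  induction rows with
  | nil => simp [intDpsi]
  | cons t ts ih =>
    simp only [List.all_cons, Bool.and_eq_true] at hwf hc
    have h1 := rowLowerQ_le hwf.1 K hc.1
    have h2 := ih hwf.2 hc.2
    simp only [intDpsi, List.map_cons, List.sum_cons] at h2 ⊢
    rw [Rat.cast_add]
    exact add_le_add h1 h2

/-- **`∫_{Ω_E} dψ + ∫_{Ω′_E} dψ ≥ 24.1876850974`** (printed `18.04470204… + 6.14298325… = 24.18768529…`): sixty terms of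
each row series and the second-order tails, evaluated exactly over `ℚ` by the kernel. [cite: RhinViola2001, §5 pp. 292–293] -/
theorem intDpsi_lower_sharp : (24.1876850974 : ℝ) ≤ intDpsi omegaRows + intDpsi omegaRows' := by
  have h1 := lowerSumQ_le omegaRows omegaRows_separated.1.1 60 (by decide +kernel)
  have h2 := lowerSumQ_le omegaRows' omegaRows_separated.2.1 60 (by decide +kernel)
  have hq : (120938425487 / 5000000000 : ℚ) ≤ (omegaRows.map fun t => rowLowerQ t 60).sum +
      (omegaRows'.map fun t => rowLowerQ t 60).sum := by decide +kernel
  have hr := (Rat.cast_le (K := ℝ)).2 hq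
  rw [Rat.cast_add] at hr
  have hL : (((120938425487 / 5000000000 : ℚ)) : ℝ) = 120938425487 / 5000000000 := by norm_num
  rw [hL] at hr
  have h24 : (24.1876850974 : ℝ) = 120938425487 / 5000000000 := by norm_num
  rw [h24]
  linarith

/-- **`c₂ ≤ 29.8123149026`** (printed `c₂ = 29.81231469…`). [cite: RhinViola2001, §5 p. 293] -/
theorem c2_le_sharp : 54 - (intDpsi omegaRows + intDpsi omegaRows') ≤ (29.8123149026 : ℝ) := by
  linarith [intDpsi_lower_sharp]


end Section5

end Literature.NumberTheory.Irrationality.RhinViola2001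

end
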